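import Mathlib.Data.Matrix.Mul
import Mathlib.Data.Matrix.Basic
import Mathlib.LinearAlgebra.Matrix.Trace
import Mathlib.Algebra.Order.BigOperators.Ring.Finset
import HarnessLib

/-!
# The trace-of-powers certificate for bilinear forms (Allen–O'Donnell–Witmer 2015, App. A)

Trunk T-CPLX-CORE (Literature/Computability/Complexity). Support file for the discharge of the
named fact `allen_odonnell_witmer_kSAT` (`AOWRefutation.lean`): the DETERMINISTIC inequality by
which a spectral refutation algorithm certifies that a bilinear form `yᵀ B z` is small for ALL
sign vectors `y, z` from ONE computable integer, the trace of a power of `BᵀB`.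

Allen–O'Donnell–Witmer (arXiv:1505.04383, App. A, proof of Lemma A.1, Claim "‖A‖^{2r} ≤
tr((AAᵀ)^r)") bound the operator norm by the trace of a power ("the trace method",
Füredi–Komlós 1981). We avoid operator norms and the spectral theorem altogether and prove the
consequence that is actually used, by iterated Cauchy–Schwarz, over any linearly ordered
commutative ring (the algorithm works over `ℤ`):

* `mulVec_dotProduct_mulVec_le_trace` — `(Cz)ᵀ(Cz) ≤ (zᵀz) · tr(CᵀC)` (Frobenius bound);
* `sq_dotProduct_mulVec_le` — `(zᵀMz)² ≤ (zᵀz) · zᵀM²z` for symmetric `M`;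
* `pow_dotProduct_mulVec_le` — `(zᵀMz)^(2^(j+1)) ≤ (zᵀz)^(2^(j+1)-1) · zᵀM^(2^(j+1))z`;
* `bilinear_pow_le_trace` — **the certificate**:
  `(yᵀBz)^(2·2^j) ≤ (yᵀy)^(2^j) (zᵀz)^(2^j) tr((BᵀB)^(2^j))`.

For `y, z` with `±1` entries (`yᵀy = |ι|`, `zᵀz = |κ|`) this reads
`|yᵀBz| ≤ |ι|^{1/2} |κ|^{1/2} tr((BᵀB)^q)^{1/2q}`, i.e. the norm bound with `‖B‖` replaced by the
computable over-estimate `tr((BᵀB)^q)^{1/2q} ≤ (rank)^{1/2q} ‖B‖`.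

## References

* S. R. Allen, R. O'Donnell, D. Witmer, *How to refute a random CSP*, FOCS 2015,
  arXiv:1505.04383, App. A (proof of Thm. 4.1; Claim in the proof of Lemma A.1).
* Z. Füredi, J. Komlós, *The eigenvalues of random symmetric matrices*, Combinatorica 1 (1981)
  (the trace method).
-/

namespace Literature.Computability.Complexity

open Matrix

variable {ι κ R : Type} [Fintype ι] [Fintype κ]
variable [CommRing R] [LinearOrder R] [IsStrictOrderedRing R]

/-- A self dot product is nonnegative in a linearly ordered ring. [folklore] -/
theorem dotProduct_self_nonneg' (z : κ → R) : 0 ≤ z ⬝ᵥ z :=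
  Finset.sum_nonneg fun i _ => mul_self_nonneg (z i)

omit [LinearOrder R] [IsStrictOrderedRing R] in
/-- `zᵀ (CᵀC) z = (Cz)ᵀ (Cz)`. [folklore] -/
theorem dotProduct_transpose_mul_self_mulVec (C : Matrix ι κ R) (z : κ → R) :
    z ⬝ᵥ ((Cᵀ * C) *ᵥ z) = (C *ᵥ z) ⬝ᵥ (C *ᵥ z) := by
  rw [← mulVec_mulVec, dotProduct_mulVec, vecMul_transpose]

/-- **Frobenius bound.** `(Cz)ᵀ(Cz) ≤ (zᵀz) · tr(CᵀC)`: each coordinate `(Cz)_i = ∑_l C_il z_l` is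
bounded by Cauchy–Schwarz, and `∑_{i,l} C_il² = tr(CᵀC)`. [Allen–O'Donnell–Witmer 2015, App. A
(trace method); Füredi–Komlós 1981] [folklore] -/
theorem mulVec_dotProduct_mulVec_le_trace (C : Matrix ι κ R) (z : κ → R) :
    (C *ᵥ z) ⬝ᵥ (C *ᵥ z) ≤ (z ⬝ᵥ z) * (Cᵀ * C).trace := by
  have h : ∀ i, (C *ᵥ z) i * (C *ᵥ z) i ≤ (∑ l, C i l * C i l) * (z ⬝ᵥ z) := by
    intro i
    have hcs := Finset.sum_mul_sq_le_sq_mul_sq Finset.univ (fun l => C i l) z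
    simp only [sq] at hcs
    exact hcs
  calc (C *ᵥ z) ⬝ᵥ (C *ᵥ z) = ∑ i, (C *ᵥ z) i * (C *ᵥ z) i := rfl
    _ ≤ ∑ i, (∑ l, C i l * C i l) * (z ⬝ᵥ z) := Finset.sum_le_sum fun i _ => h i
    _ = (z ⬝ᵥ z) * (Cᵀ * C).trace := by
        rw [← Finset.sum_mul, mul_comm]
        congr 1
        simp only [Matrix.trace, Matrix.diag, Matrix.mul_apply, Matrix.transpose_apply]
        exact Finset.sum_comm

/-- `zᵀ (CᵀC) z ≤ (zᵀz) · tr(CᵀC)`. [Allen–O'Donnell–Witmer 2015, App. A] [folklore] -/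
theorem dotProduct_transpose_mul_self_mulVec_le (C : Matrix ι κ R) (z : κ → R) :
    z ⬝ᵥ ((Cᵀ * C) *ᵥ z) ≤ (z ⬝ᵥ z) * (Cᵀ * C).trace := by
  rw [dotProduct_transpose_mul_self_mulVec]
  exact mulVec_dotProduct_mulVec_le_trace C z

/-- Cauchy–Schwarz for a bilinear form: `(yᵀBz)² ≤ (yᵀy) · zᵀ(BᵀB)z`. [folklore] -/
theorem sq_dotProduct_bilin_le (B : Matrix ι κ R) (y : ι → R) (z : κ → R) :
    (y ⬝ᵥ (B *ᵥ z)) ^ 2 ≤ (y ⬝ᵥ y) * (z ⬝ᵥ ((Bᵀ * B) *ᵥ z)) := by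
  rw [dotProduct_transpose_mul_self_mulVec]
  have hcs := Finset.sum_mul_sq_le_sq_mul_sq Finset.univ y (B *ᵥ z)
  simp only [sq] at hcs ⊢
  exact hcs

/-- One Cauchy–Schwarz step for a symmetric matrix: `(zᵀMz)² ≤ (zᵀz) · zᵀM²z`. [folklore] -/
theorem sq_dotProduct_mulVec_le [DecidableEq κ] (M : Matrix κ κ R) (hM : Mᵀ = M) (z : κ → R) :
    (z ⬝ᵥ (M *ᵥ z)) ^ 2 ≤ (z ⬝ᵥ z) * (z ⬝ᵥ ((M * M) *ᵥ z)) := by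
  have h := sq_dotProduct_bilin_le M z z
  rwa [hM] at h

/-- Iterated Cauchy–Schwarz (power-mean step of the trace method): for symmetric `M` and
`q = 2^(j+1)`, `(zᵀMz)^q ≤ (zᵀz)^(q-1) · zᵀ M^q z`. [Allen–O'Donnell–Witmer 2015, App. A;
Füredi–Komlós 1981] [folklore] -/
theorem pow_dotProduct_mulVec_le [DecidableEq κ] (M : Matrix κ κ R) (hM : Mᵀ = M) (z : κ → R)
    (j : ℕ) :
    (z ⬝ᵥ (M *ᵥ z)) ^ 2 ^ (j + 1) ≤ (z ⬝ᵥ z) ^ (2 ^ (j + 1) - 1) * (z ⬝ᵥ (M ^ 2 ^ (j + 1) *ᵥ z)) := by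
  induction j with
  | zero =>
    simpa [pow_two] using sq_dotProduct_mulVec_le M hM z
  | succ j ih =>
    have hz : 0 ≤ z ⬝ᵥ z := dotProduct_self_nonneg' z
    -- the matrix `M' = M ^ 2^(j+1)` is symmetric
    have hM' : (M ^ 2 ^ (j + 1))ᵀ = M ^ 2 ^ (j + 1) := by rw [transpose_pow, hM]
    have heven : Even (2 ^ (j + 1)) := by rw [pow_succ']; exact even_two_mul _
    have h0 : 0 ≤ (z ⬝ᵥ (M *ᵥ z)) ^ 2 ^ (j + 1) := heven.pow_nonneg _
    -- square the induction hypothesis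
    have h1 : ((z ⬝ᵥ (M *ᵥ z)) ^ 2 ^ (j + 1)) ^ 2 ≤
        ((z ⬝ᵥ z) ^ (2 ^ (j + 1) - 1) * (z ⬝ᵥ (M ^ 2 ^ (j + 1) *ᵥ z))) ^ 2 :=
      pow_le_pow_left₀ h0 ih 2
    -- apply the one-step bound to `M'`
    have h2 := sq_dotProduct_mulVec_le (M ^ 2 ^ (j + 1)) hM' z
    have hpow : M ^ 2 ^ (j + 1) * M ^ 2 ^ (j + 1) = M ^ 2 ^ (j + 1 + 1) := by
      rw [← pow_add, ← two_mul, ← pow_succ']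
    rw [hpow] at h2
    have hq : 2 ^ (j + 1 + 1) = 2 ^ (j + 1) * 2 := pow_succ 2 (j + 1)
    have hq1 : 1 ≤ 2 ^ (j + 1) := Nat.one_le_two_pow
    calc (z ⬝ᵥ (M *ᵥ z)) ^ 2 ^ (j + 1 + 1)
        = ((z ⬝ᵥ (M *ᵥ z)) ^ 2 ^ (j + 1)) ^ 2 := by rw [hq, pow_mul]
      _ ≤ ((z ⬝ᵥ z) ^ (2 ^ (j + 1) - 1) * (z ⬝ᵥ (M ^ 2 ^ (j + 1) *ᵥ z))) ^ 2 := h1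
      _ = (z ⬝ᵥ z) ^ (2 * (2 ^ (j + 1) - 1)) * (z ⬝ᵥ (M ^ 2 ^ (j + 1) *ᵥ z)) ^ 2 := by
          rw [mul_pow, ← pow_mul, mul_comm (2 ^ (j + 1) - 1) 2]
      _ ≤ (z ⬝ᵥ z) ^ (2 * (2 ^ (j + 1) - 1)) * ((z ⬝ᵥ z) * (z ⬝ᵥ (M ^ 2 ^ (j + 1 + 1) *ᵥ z))) :=
          mul_le_mul_of_nonneg_left h2 (pow_nonneg hz _)
      _ = (z ⬝ᵥ z) ^ (2 ^ (j + 1 + 1) - 1) * (z ⬝ᵥ (M ^ 2 ^ (j + 1 + 1) *ᵥ z)) := by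
          rw [← mul_assoc, ← pow_succ]
          congr 2
          omega

/-- **The trace certificate** (Allen–O'Donnell–Witmer's `‖A‖^{2r} ≤ tr((AAᵀ)^r)` in the form
used by the refutation algorithm, with no appeal to eigenvalues): for every matrix `B`, vectors
`y, z` and `q = 2^j`,
`(yᵀBz)^{2q} ≤ (yᵀy)^q (zᵀz)^q · tr((BᵀB)^q)`.
[Allen–O'Donnell–Witmer 2015, App. A, proof of Lemma A.1 (Claim); Füredi–Komlós 1981] [cite: arXiv150504383, App. A] -/
theorem bilinear_pow_le_trace [DecidableEq κ] (B : Matrix ι κ R) (y : ι → R) (z : κ → R)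
    (j : ℕ) :
    (y ⬝ᵥ (B *ᵥ z)) ^ (2 * 2 ^ j) ≤
      (y ⬝ᵥ y) ^ 2 ^ j * (z ⬝ᵥ z) ^ 2 ^ j * ((Bᵀ * B) ^ 2 ^ j).trace := by
  set M : Matrix κ κ R := Bᵀ * B with hMdef
  have hM : Mᵀ = M := by rw [hMdef, transpose_mul, transpose_transpose]
  have hy : 0 ≤ y ⬝ᵥ y := dotProduct_self_nonneg' y
  have hz : 0 ≤ z ⬝ᵥ z := dotProduct_self_nonneg' z
  -- first Cauchy–Schwarz, raised to the `q`-th power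
  have h1 : (y ⬝ᵥ (B *ᵥ z)) ^ (2 * 2 ^ j) ≤ ((y ⬝ᵥ y) * (z ⬝ᵥ (M *ᵥ z))) ^ 2 ^ j := by
    rw [pow_mul]
    exact pow_le_pow_left₀ (sq_nonneg _) (sq_dotProduct_bilin_le B y z) _
  refine h1.trans ?_
  rw [mul_pow, mul_assoc]
  refine mul_le_mul_of_nonneg_left ?_ (pow_nonneg hy _)
  -- it remains: `(zᵀMz)^q ≤ (zᵀz)^q tr(M^q)`
  cases j with
  | zero =>
    simp only [pow_zero, pow_one]
    exact dotProduct_transpose_mul_self_mulVec_le B z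
  | succ j =>
    have h2 := pow_dotProduct_mulVec_le M hM z j
    -- `M^q = CᵀC` with `C = M^(q/2)`
    have hC : (M ^ 2 ^ j)ᵀ * M ^ 2 ^ j = M ^ 2 ^ (j + 1) := by
      rw [transpose_pow, hM, ← pow_add, ← two_mul, ← pow_succ']
    have h3 := dotProduct_transpose_mul_self_mulVec_le (M ^ 2 ^ j) z
    rw [hC] at h3
    have hq1 : 1 ≤ 2 ^ (j + 1) := Nat.one_le_two_pow
    calc (z ⬝ᵥ (M *ᵥ z)) ^ 2 ^ (j + 1)
        ≤ (z ⬝ᵥ z) ^ (2 ^ (j + 1) - 1) * (z ⬝ᵥ (M ^ 2 ^ (j + 1) *ᵥ z)) := h2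
      _ ≤ (z ⬝ᵥ z) ^ (2 ^ (j + 1) - 1) * ((z ⬝ᵥ z) * (M ^ 2 ^ (j + 1)).trace) :=
          mul_le_mul_of_nonneg_left h3 (pow_nonneg hz _)
      _ = (z ⬝ᵥ z) ^ 2 ^ (j + 1) * (M ^ 2 ^ (j + 1)).trace := by
          rw [← mul_assoc, ← pow_succ, Nat.sub_add_cancel hq1]

/-- Contrapositive reading used by the algorithm: if `tr((BᵀB)^q) · (yᵀy)^q (zᵀz)^q · c^{2q} < m^{2q}`
for some `c, m ≥ 0`, then `c · |yᵀBz| < m`. [Allen–O'Donnell–Witmer 2015, App. A] [folklore] -/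
theorem mul_abs_bilinear_lt_of_trace_lt [DecidableEq κ] (B : Matrix ι κ R) (y : ι → R) (z : κ → R)
    (j : ℕ) {c m : R} (hc : 0 ≤ c) (hm : 0 ≤ m)
    (h : c ^ (2 * 2 ^ j) * ((y ⬝ᵥ y) ^ 2 ^ j * (z ⬝ᵥ z) ^ 2 ^ j * ((Bᵀ * B) ^ 2 ^ j).trace) <
      m ^ (2 * 2 ^ j)) :
    c * |y ⬝ᵥ (B *ᵥ z)| < m := by
  by_contra hle
  rw [not_lt] at hle
  have h1 : m ^ (2 * 2 ^ j) ≤ (c * |y ⬝ᵥ (B *ᵥ z)|) ^ (2 * 2 ^ j) := pow_le_pow_left₀ hm hle _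
  have h2 : (c * |y ⬝ᵥ (B *ᵥ z)|) ^ (2 * 2 ^ j) ≤
      c ^ (2 * 2 ^ j) * ((y ⬝ᵥ y) ^ 2 ^ j * (z ⬝ᵥ z) ^ 2 ^ j * ((Bᵀ * B) ^ 2 ^ j).trace) := by
    rw [mul_pow]
    refine mul_le_mul_of_nonneg_left ?_ (pow_nonneg hc _)
    have heven : Even (2 * 2 ^ j) := even_two_mul _
    rw [heven.pow_abs]
    exact bilinear_pow_le_trace B y z j
  exact absurd h (not_lt.2 (le_trans h1 h2))

end Literature.Computability.Complexity
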